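import Summits.NavierStokesRegularity.NavierStokesRegularity.Theorems.StretchingWellBindingEnstrophyQuarterLawSparseSieveDefs
import Summits.NavierStokesRegularity.NavierStokesRegularity.Theorems.StretchingWellBindingEnstrophyQuarterLawFarFieldEnstrophy
import HarnessLib

/-!
# Shelf crux `EnstrophyQuarterLaw` (stmt-NavierStokesRegularity-1574), line «sparse_sieve»:
# registered stub `stub_farFieldEnstrophy` BY NAME

`--supports stmt-NavierStokesRegularity-1574` (registered stub `stub_farFieldEnstrophy` of the skeleton of record
`Cruxes/EnstrophyQuarterLaw/Lines/sparse_sieve.lean`, sha `3cd087f404df…`). The CONTENT of this stub landed on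
2026-08-28 as `…Theorems.EnstrophyQuarterLaw.SparseSieve.stub_farFieldEnstrophy` (p607039) with the skeleton's predicate(s)
unfolded, because the predicates were then local to the (non-importable) skeleton module. With the predicates now
importable VERBATIM from `…Theorems.EnstrophyQuarterLaw.SparseSieve` (file `…SparseSieveDefs`), this file states the
REGISTERED signature literally and proves it by the landed theorem (the two types are definitionally equal: the
predicates unfold to the landed hypotheses/conclusion). Registry bookkeeping, no new mathematics:
for a maximal classical solution `u` on `[0,T)` (`ν, T > 0`), Leray–Hopf from its rapidly decaying datum, `FarFieldEnstrophy T u` — outside some ball the enstrophy stays bounded on `[T/2, T)` (Tao 2011/2013 Thm 10.1, exterior form of Rem. 10.6; tree fact `tao2011_enstrophyLocalisation_exterior_holds`).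
HONEST FRAMING: the crux `EnstrophyQuarterLaw` (1574), its open stubs `stub_uniformLocalTypeI` (S1),
`stub_uniformSparseness` (S2) and `stub_noTypeII` (= stmt-0056) stay OPEN; nothing here bears on Navier–Stokes
regularity; no summit statement is proved.
-/

noncomputable section

-- the summit and its single sub-problem share the name (CONVENTIONS §1), as in every Theorems file
set_option linter.dupNamespace false

namespace Summit.NavierStokesRegularity.NavierStokesRegularity.Theorems.EnstrophyQuarterLaw.SparseSieve.Registered

open MeasureTheory Set Metric
open Literature.Analysis.FluidPDE
open scoped ENNReal

/-- Registered stub `stub_farFieldEnstrophy` of line «sparse_sieve» on the shelf crux `EnstrophyQuarterLaw`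
(stmt-NavierStokesRegularity-1574), signature VERBATIM (predicates of `…SparseSieveDefs`):
for a maximal classical solution `u` on `[0,T)` (`ν, T > 0`), Leray–Hopf from its rapidly decaying datum, `FarFieldEnstrophy T u` — outside some ball the enstrophy stays bounded on `[T/2, T)` (Tao 2011/2013 Thm 10.1, exterior form of Rem. 10.6; tree fact `tao2011_enstrophyLocalisation_exterior_holds`).
Proof: the landed content theorem `…Theorems.EnstrophyQuarterLaw.SparseSieve.stub_farFieldEnstrophy` (p607039), whose type is the
same statement with the predicate(s) unfolded (definitional equality). [folklore] -/
theorem stub_farFieldEnstrophy : ∀ (ν T : ℝ), 0 < ν → 0 < T → ∀ (u : ℝ → EuclideanSpace ℝ (Fin 3) → EuclideanSpace ℝ (Fin 3)) (p : ℝ → EuclideanSpace ℝ (Fin 3) → ℝ), IsMaximalSmoothSolution ν 0 u p T → IsLerayHopfOn T ν 0 (u 0) u → HasRapidSpatialDecay (u 0) →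
    FarFieldEnstrophy T u :=
  _root_.Summit.NavierStokesRegularity.NavierStokesRegularity.Theorems.EnstrophyQuarterLaw.SparseSieve.stub_farFieldEnstrophy

end Summit.NavierStokesRegularity.NavierStokesRegularity.Theorems.EnstrophyQuarterLaw.SparseSieve.Registered

end
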